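import Literature.MathematicalPhysics.QuantumFieldTheory.Balaban1983to89.B9Eq325QGGQInvZd

/-!
# `Balaban1983to89.B9Eq325QprimeSingleSiteZd` — [Balaban1985BackgroundPropagators] (3.19) p. 393 `Q′_j(U) = Q′(Ūʲ⁻¹)⋯Q′(U)` ON A SINGLE-SITE FIELD at the
# `ℤᵈ × 𝔸` carrier: the FIBRE TRANSPORT FORMULA `(Q′_j(U₀)(δ_x X))(y) = 𝟙[blockMap^[j] x = y] · L^{−jd} · R(Ū₀^{j−1}(Γ))⋯R(U₀(Γ)) X` for EVERY background of units,
# its SURJECTIVITY in the fibre variable `X`, and the reduction of `B9Eq325QGGQInvZd.SeparatingSites` — the one displayed clause under which `(Q′G′²Q′*)⁻¹`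
# (and (3.25)) exist at the carrier — to PURE BLOCK GEOMETRY (`LevelDisjoint`: each constraint point `(j, y)` owns a site of `Ω₀` in its `j`-block whose other
# block images avoid the other constraint points — print's «Λ_j = Ω_j^{(j)} ∖ Ω_{j+1}^{(j)}»)

statement-level skeleton of published theorems with citation tags; proofs where landed; nothing here is a claim about the
Yang–Mills mass gap

`[Balaban1985BackgroundPropagators]` ("B9", CMP **99** (1985) 389–434) p. 393: *«we define Λ_j = Ω_j^{(j)} ∖ Ω_{j+1}^{(j)}, j = 0, 1, …, k, Ω_{k+1} = ∅, or
Ω_j ∖ Ω_{j+1} = Bʲ(Λ_j), hence Λ_j ⊂ T^{(j)}_{Lʲη} … (Q′(U)λ)(y) = Σ_{x∈B(y)} L⁻ᵈ R(U(Γ_{y,x}))λ(x), (3.18) … Q′_j(U) = Q′(Ūʲ⁻¹)⋯Q′(Ū)Q′(U), (3.19)»*; p. 394 (3.25)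
(`(Q′G′²Q′*)⁻¹`).  [Balaban1985Averaging] (78)–(80) p. 30 (the block geometry `zdBlocking`: blocks `blockSites L y`, weights `L⁻ᵈ`).
PDF held: `paper:balaban1985-cmp99-background-propagators` pp. 393–394 (re-read by this seat, 2026-08-28).

CITATION HEADER (lean-in-tree rule).  Cell `pub-ymgap` (YM Track A, HUMAN RULING D-0062 ∕ D-0149 width push), DAG node N06 = [B9], width seat
`pub-ymgap-dag-n06-w4` (g2), continuing `B9Eq325QGGQInvZd` (p599165): there the invertibility of `Q′G′²Q′*` was proved under the displayed injectivity of `Q′*`,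
reduced to `SeparatingSites` (surjective single-site fibre maps + blindness of the other constraint points).  THIS FILE computes `Q′_j` on single-site fields in
CLOSED FORM for the tree's block geometry (`zdBlocking d L`, transporters `bgT L U₀`), whence surjectivity is automatic (conjugations by units, weights `L⁻ᵈ ≠ 0`)
and blindness is a statement about ITERATED BLOCK MAPS only: `SeparatingSites ⟸ LevelDisjoint`, the latter free of `U₀` and of `𝔸`.  Deriving `LevelDisjoint`
for a member class (the cube members `B8CubeMemberZd.cubeLamS`: `x := Lʲ·y`, nesting `□_j ⊂ □_{i+1}`) is box arithmetic for the law owners — NOT done here.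

WHAT IS DECLARED ∕ PROVED (kernel, 0 sorry; definitions with bodies + theorems; no `instance`, no `notation`).
* §1 `blockMapIter L j` (`blockMap L` iterated `j` times; `_zero ∕ _succ`; `blockMapIter_eq_blockMap_pow` : `= blockMap (Lʲ)`), `trIter L U₀ j x X` (the level-`j` fibre transport of `X` up the block tower of `x`:
  `trIter 0 = X`, `trIter (j+1) = L⁻ᵈ · R(Ū₀ʲ(Γ_{y_{j+1}, y_j})) (trIter j)`, `y_i = blockMap^[i] x`), ★★ `QprimeIter_single` (THE FORMULA
  `(Q′_j(U₀)(δ_x X))(y) = if blockMap^[j] x = y then trIter L U₀ j x X else 0` — induction on (3.19)), ★ `trIter_surjective` (`L ≠ 0`; any units).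
* §2 `LevelDisjoint L m Λ s` (def Prop — GEOMETRY ONLY: `∀ (j, y) ∈ 𝔅, ∃ x ∈ Ω₀, blockMap^[j] x = y ∧ ∀ (i, y′) ∈ 𝔅, (i, y′) ≠ (j, y) → blockMap^[i] x ≠ y′`),
  ★★ `separatingSites_of_levelDisjoint` (⟹ `SeparatingSites L U₀ m Λ s` for EVERY background of units `U₀`), ★ `qprimeStarInjective_of_levelDisjoint`
  (⟹ `Q′*` injective — so `B9Eq325QGGQInvZd.cZd` ∕ `B9Eq325ProjFormulaZd.projE_eq_Rop_of_herm` apply — for every unitary `U₀`, Hermitian faithful `τ`),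
  `levelDisjoint_levelZero` (A6: at `m = 0`, `Λ_0 ⊆ Ω₀`).

HONEST SCOPE.  Averaging algebra at the `ℤᵈ` carrier; no estimate; the member-class geometry (`LevelDisjoint` for `cubeLamS` etc.) is displayed, not derived.
Count-neutral; N05 ∕ N06 NOT discharged; K1⁷ `stmt-QuantumFields-20542` NOT closed; one finite `𝕋⁴` programme at fixed `ε`, Bałaban as printed; R4 closes only the
conditional finite-`𝕋⁴` rung `BalabanLadder.UV` — nothing continuum ∕ ℝ⁴ ∕ OS ∕ mass gap ∕ Clay.  Unit `pub-ymgap-dag-n06-w4` (g2), 2026-08-28.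
-/

noncomputable section

namespace Literature.MathematicalPhysics.QuantumFieldTheory.Balaban1983to89.B9Eq325QprimeSingleSiteZd

open B7Prop1Explicit B7Eq78Linearization
open B7Prop2Explicit (unitaryUnits)
open B8Eq119TwistedAxial (bgT)
open Literature.MathematicalPhysics.QuantumLattice (blockMap blockSites mem_blockSites_iff)
open B9Eq324DeltaPrimeAZd (single)
open B9Eq325QGGQInvZd (SeparatingSites QprimeStarInjective qprimeStarInjective_of_separating)

-- `Site` alone could resolve to the torus sites of `Setup.lean`; re-export the `ℤ^d` sites of `B7Prop1Explicit`.
export B7Prop1Explicit (Site)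

variable {d : ℕ} {𝔸 : Type*} [CStarAlgebra 𝔸]

/-! ## §1  `Q′_j(U₀)` on a single-site field: the fibre transport formula -/

section Formula

variable (L : ℕ) (U₀ : Site d → Fin d → 𝔸ˣ)

/-- **THE ITERATED BLOCK MAP** `blockMap^[j]` (`y_j = blockMap^[j] x` is the level-`j` block containing `x`).
[cite: Balaban1985BackgroundPropagators, (3.18)–(3.19) p.393; Balaban1985Averaging, (78)–(80) p.30] -/
def blockMapIter (L : ℕ) : ℕ → Site d → Site d
  | 0 => id
  | j + 1 => fun x => blockMap L (blockMapIter L j x)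

/-- `blockMap^[0] = id`. [cite: Balaban1985BackgroundPropagators, (3.19) p.393 (bookkeeping)] -/
@[simp] theorem blockMapIter_zero (x : Site d) : blockMapIter L 0 x = x := rfl

/-- `blockMap^[j+1] x = blockMap (blockMap^[j] x)`. [cite: Balaban1985BackgroundPropagators, (3.19) p.393 (bookkeeping)] -/
theorem blockMapIter_succ (j : ℕ) (x : Site d) : blockMapIter L (j + 1) x = blockMap L (blockMapIter L j x) := rfl

/-- `blockMap^[j] = blockMap (Lʲ)` — the iterated block map is the block map of the `Lʲ`-blocks (`(x_i ∕ Lʲ) ∕ L = x_i ∕ L^{j+1}` for `L ≥ 0`; the tree's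
`B9B8AveragingJunction.blockMap_iterate` is the same on `Fin (d+1) → ℤ`). [cite: Balaban1985BackgroundPropagators, (3.19) p.393; Balaban1985Averaging, (78)–(80) p.30] -/
theorem blockMapIter_eq_blockMap_pow (j : ℕ) (x : Site d) : blockMapIter L j x = blockMap (L ^ j) x := by
  induction j with
  | zero => funext i; simp [blockMapIter, blockMap]
  | succ j ih => rw [blockMapIter_succ, ih, B7BlockGeometry.blockMap_blockMap, pow_succ]

/-- **THE LEVEL-`j` FIBRE TRANSPORT** of `X ∈ 𝔸` up the block tower of `x`: `trIter 0 x X = X`,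
`trIter (j+1) x X = L⁻ᵈ · R(Ū₀ʲ(Γ_{y_{j+1}, y_j})) (trIter j x X)` with `y_i = blockMap^[i] x` — the coefficient of `Q′_j(U₀)` on the single-site field `δ_x X`.
[cite: Balaban1985BackgroundPropagators, (3.18)–(3.19) p.393] -/
def trIter (L : ℕ) (U₀ : Site d → Fin d → 𝔸ˣ) : ℕ → Site d → 𝔸 → 𝔸
  | 0, _, X => X
  | j + 1, x, X => (((L : ℝ) ^ d)⁻¹) • conjR (bgT L U₀ j (blockMapIter L (j + 1) x) (blockMapIter L j x)) (trIter L U₀ j x X)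

/-- `trIter 0 x X = X`. [cite: Balaban1985BackgroundPropagators, (3.19) p.393 (bookkeeping)] -/
@[simp] theorem trIter_zero (x : Site d) (X : 𝔸) : trIter L U₀ 0 x X = X := rfl

/-- the recursion of `trIter`. [cite: Balaban1985BackgroundPropagators, (3.19) p.393 (bookkeeping)] -/
theorem trIter_succ (j : ℕ) (x : Site d) (X : 𝔸) :
    trIter L U₀ (j + 1) x X = (((L : ℝ) ^ d)⁻¹) • conjR (bgT L U₀ j (blockMapIter L (j + 1) x) (blockMapIter L j x)) (trIter L U₀ j x X) := rfl

variable [NeZero L]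

/-- ★★ **`Q′_j(U₀)` ON A SINGLE-SITE FIELD**: `(Q′_j(U₀)(δ_x X))(y) = if blockMap^[j] x = y then trIter L U₀ j x X else 0` — the `j`-fold average of a field
supported at `x` lives on the single level-`j` block containing `x`, with value the transported, `L^{−jd}`-weighted `X` (induction on (3.19): at each step only the
block containing the previous point contributes). [cite: Balaban1985BackgroundPropagators, (3.18)–(3.19) p.393] -/
theorem QprimeIter_single (x : Site d) (X : 𝔸) :
    ∀ (j : ℕ) (y : Site d), QprimeIter (zdBlocking d L) (bgT L U₀) j (single x X) y = if blockMapIter L j x = y then trIter L U₀ j x X else 0 := by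
  classical
  intro j
  induction j with
  | zero =>
    intro y
    simp only [QprimeIter_zero, blockMapIter_zero, trIter_zero, single]
    by_cases h : y = x
    · rw [if_pos h, if_pos h.symm]
    · rw [if_neg h, if_neg (Ne.symm h)]
  | succ j ih =>
    intro y
    rw [QprimeIter_succ]
    show ∑ x' ∈ blockSites L y, ((L : ℝ) ^ d)⁻¹ • conjR (bgT L U₀ j y x') (QprimeIter (zdBlocking d L) (bgT L U₀) j (single x X) x') = _
    simp_rw [ih]
    by_cases hy : blockMapIter L (j + 1) x = y
    · -- the previous point `blockMap^[j] x` lies in the block of `y`; it is the only contributing summand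
      rw [if_pos hy]
      have hmem : blockMapIter L j x ∈ blockSites L y := (mem_blockSites_iff L y _).2 (by rw [← hy]; rfl)
      rw [Finset.sum_eq_single_of_mem (blockMapIter L j x) hmem fun x' _ hx' => by rw [if_neg (Ne.symm hx'), conjR_zero', smul_zero]]
      rw [if_pos rfl, trIter_succ, hy]
    · rw [if_neg hy]
      refine Finset.sum_eq_zero fun x' hx' => ?_
      have hne : blockMapIter L j x ≠ x' := by
        intro h
        apply hy
        rw [blockMapIter_succ, h]
        exact (mem_blockSites_iff L y x').1 hx'
      rw [if_neg hne, conjR_zero', smul_zero]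
where
  /-- `conjR u 0 = 0`. [folklore] -/
  conjR_zero' (u : 𝔸ˣ) : conjR u (0 : 𝔸) = 0 := by rw [conjR_apply, mul_zero, zero_mul]

omit [NeZero L] in
/-- ★ **THE FIBRE TRANSPORT IS SURJECTIVE** (indeed bijective): each step is a non-zero real multiple of a conjugation by a unit (`L ≠ 0`; ANY background of units).
[cite: Balaban1985BackgroundPropagators, (3.18)–(3.19) p.393] -/
theorem trIter_surjective (hL : L ≠ 0) (x : Site d) : ∀ j : ℕ, Function.Surjective (trIter L U₀ j x) := by
  intro j
  induction j with
  | zero => exact fun Y => ⟨Y, rfl⟩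
  | succ j ih =>
    intro Y
    set u := bgT L U₀ j (blockMapIter L (j + 1) x) (blockMapIter L j x)
    -- solve `L⁻ᵈ · R(u) Z = Y` for `Z`, then `Z = trIter j x X`
    obtain ⟨X, hX⟩ := ih (conjR u⁻¹ (((L : ℝ) ^ d) • Y))
    refine ⟨X, ?_⟩
    have hLd : ((L : ℝ) ^ d) ≠ 0 := pow_ne_zero _ (Nat.cast_ne_zero.2 hL)
    have hconj : conjR u (conjR u⁻¹ (((L : ℝ) ^ d) • Y)) = ((L : ℝ) ^ d) • Y := by
      rw [conjR_apply, conjR_apply, inv_inv]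
      simp only [mul_assoc, Units.mul_inv, mul_one, Units.mul_inv_cancel_left]
    rw [trIter_succ, hX, hconj, inv_smul_smul₀ hLd]

end Formula

/-! ## §2  `SeparatingSites ⟸ LevelDisjoint` (geometry only) -/

section Geometry

variable (L : ℕ) (m : ℕ) (Λ : ℕ → Finset (Site d)) (s : Finset (Site d))

/-- **LEVEL DISJOINTNESS** — print's block geometry «Λ_j = Ω_j^{(j)} ∖ Ω_{j+1}^{(j)}, Ω_j ∖ Ω_{j+1} = Bʲ(Λ_j)» in the operational form the averaging needs: every
constraint point `(j, y) ∈ 𝔅` owns a site `x ∈ Ω₀` in its level-`j` block (`blockMap^[j] x = y`) whose level-`i` block images avoid every OTHER constraint point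
`(i, y′) ∈ 𝔅`.  A statement about iterated block maps only — no background, no fibre. [cite: Balaban1985BackgroundPropagators, (3.18)–(3.19) p.393] -/
def LevelDisjoint (L : ℕ) (m : ℕ) (Λ : ℕ → Finset (Site d)) (s : Finset (Site d)) : Prop :=
  ∀ j ∈ Finset.range (m + 1), ∀ y ∈ Λ j, ∃ x ∈ s, blockMapIter L j x = y ∧
    ∀ i ∈ Finset.range (m + 1), ∀ y' ∈ Λ i, (i, y') ≠ (j, y) → blockMapIter L i x ≠ y'

variable {L m Λ s}

/-- ★★ **`LevelDisjoint ⟹ SeparatingSites`** for EVERY background of units `U₀` (`L ≠ 0`): the owned site's fibre map is the surjective transport `trIter`, and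
the other constraint points are blind to it by the single-site formula. [cite: Balaban1985BackgroundPropagators, (3.18)–(3.19) p.393, (3.25) p.394] -/
theorem separatingSites_of_levelDisjoint [NeZero L] (U₀ : Site d → Fin d → 𝔸ˣ) (h : LevelDisjoint L m Λ s) : SeparatingSites L U₀ m Λ s := by
  intro j hj y hy
  obtain ⟨x, hxs, hxy, hblind⟩ := h j hj y hy
  refine ⟨x, hxs, ?_, ?_⟩
  · intro Y
    obtain ⟨X, hX⟩ := trIter_surjective L U₀ (NeZero.ne L) x j Y
    refine ⟨X, ?_⟩
    show QprimeIter (zdBlocking d L) (bgT L U₀) j (single x X) y = Y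
    rw [QprimeIter_single L U₀ x X j y, if_pos hxy, hX]
  · intro i hi y' hy' hne X
    rw [QprimeIter_single L U₀ x X i y', if_neg (hblind i hi y' hy' hne)]

/-- ★ **`LevelDisjoint ⟹ Q′*` INJECTIVE** on `L²(𝔅, ·)` (Hermitian faithful `τ`, finite-dimensional `𝔸`) — so `(Q′G′²Q′*)⁻¹` (`B9Eq325QGGQInvZd.cZd`) and (3.25)
(`B9Eq325ProjFormulaZd`) are available at every unitary background whenever the member's constraint geometry is level-disjoint.
[cite: Balaban1985BackgroundPropagators, (3.25) p.394, Thm 3.11 p.416] -/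
theorem qprimeStarInjective_of_levelDisjoint [NeZero L] [FiniteDimensional ℝ 𝔸] (U₀ : Site d → Fin d → 𝔸ˣ) (τ : 𝔸 →ₗ[ℂ] ℂ)
    (hτp : ∀ a : 𝔸, a ≠ 0 → 0 < (τ (star a * a)).re) (hτs : ∀ a : 𝔸, τ (star a) = starRingEnd ℂ (τ a)) (h : LevelDisjoint L m Λ s) :
    QprimeStarInjective L U₀ τ hτp m Λ s :=
  qprimeStarInjective_of_separating L U₀ τ hτp m Λ s hτs (separatingSites_of_levelDisjoint U₀ h)

/-- **A6 ∕ NON-VACUITY**: at `m = 0` with `Λ_0 ⊆ Ω₀` the geometry is level-disjoint (each point owns itself). [cite: Balaban1985BackgroundPropagators, (3.18) p.393 (j = 0)] -/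
theorem levelDisjoint_levelZero (hΛ : Λ 0 ⊆ s) : LevelDisjoint L 0 Λ s := by
  intro j hj y hy
  have hj0 : j = 0 := by simpa using hj
  subst hj0
  refine ⟨y, hΛ hy, rfl, ?_⟩
  intro i hi y' _ hne
  have hi0 : i = 0 := by simpa using hi
  subst hi0
  intro h
  exact hne (by rw [← h]; rfl)

end Geometry

end Literature.MathematicalPhysics.QuantumFieldTheory.Balaban1983to89.B9Eq325QprimeSingleSiteZd

end
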